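import Summits.CriticalPhenomena.CardyFormulaZ2.Theorems.CardyBoundaryCoulombGasHalfPlaneMarkDensityLawSubsequentialLimits

/-!
# Line `Sketch`, open stub C⁺ — a priori structure of the collinear half-plane crossing function, V:
# reflection symmetry (crux stmt-CriticalPhenomena-5661, lead c2-0)

`P_n(a,b,c,y) := P_{1/2}[[⌊an⌋,⌊bn⌋]×{0} ↔ [⌊cn⌋,⌊yn⌋]×{0} in ℤ×ℕ]`.  The reflection `v₀ ↦ −v₀` of `ℤ²`
preserves `P_{1/2}` and the lattice half-plane and swaps the two arcs (`crossing_reflect`, exact), and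
`⌊−xn⌋` is within one site of `−⌊xn⌋`, so by the joint move bound
`P_n(−y,−c,−b,−a) − P_n(a,b,c,y) → 0` (`tendsto_reflect_sub`) and every joint subsequential limit is
reflection symmetric: `G(−y,−c,−b,−a) = G(a,b,c,y)` (`reflect_of_jointLimit`).  With translation
invariance (`translate_of_jointLimit`) a joint limit is a function of the three gaps
`(b−a, c−b, y−c)`, symmetric under reversal.
-/

noncomputable section

namespace Summit.CriticalPhenomena.CardyFormulaZ2.Cruxes.HalfPlaneMarkDensityLaw.SketchLine

open Literature.Probability.Percolation Literature.Probability.LatticeModels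
open MeasureTheory Filter Set
open scoped Topology
open Summit.CriticalPhenomena.CardyFormulaZ2.Theorems.HalfPlaneMarkDensityLaw.Negative

namespace Subseq

/-! ## §9 Exact lattice reflection -/

/-- The reflection `v₀ ↦ −v₀` of `ℤ²` is an involution. [folklore] -/
theorem reflect_reflect (v : Site 2) : reflectIso (d := 2) 0 (reflectIso (d := 2) 0 v) = v := by
  funext m
  by_cases hm : m = 0
  · subst hm
    rw [reflectIso_apply_same, reflectIso_apply_same, neg_neg]
  · rw [reflectIso_apply_of_ne hm, reflectIso_apply_of_ne hm]

/-- The reflection `v₀ ↦ −v₀` maps the boundary segment `[i,j]×{0}` onto `[−j,−i]×{0}`. [folklore] -/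
theorem image_reflect_rowIcc (i j : ℤ) :
    (reflectIso (d := 2) 0) '' rowIcc i j = rowIcc (-j) (-i) := by
  ext v
  simp only [mem_image, rowIcc, mem_setOf_eq]
  constructor
  · rintro ⟨w, ⟨hw1, hw2, hw3⟩, rfl⟩
    refine ⟨?_, ?_, ?_⟩
    · rw [reflectIso_apply_of_ne (by decide)]; exact hw1
    · rw [reflectIso_apply_same]; omega
    · rw [reflectIso_apply_same]; omega
  · rintro ⟨hv1, hv2, hv3⟩
    refine ⟨reflectIso (d := 2) 0 v, ⟨?_, ?_, ?_⟩, ?_⟩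
    · rw [reflectIso_apply_of_ne (by decide)]; exact hv1
    · rw [reflectIso_apply_same]; omega
    · rw [reflectIso_apply_same]; omega
    · exact reflect_reflect v

/-- The reflection `v₀ ↦ −v₀` preserves the lattice half-plane. [folklore] -/
theorem image_reflect_halfPlane : (reflectIso (d := 2) 0) '' halfPlane = halfPlane := by
  ext v
  simp only [mem_image, halfPlane, mem_setOf_eq]
  constructor
  · rintro ⟨w, hw, rfl⟩
    rw [reflectIso_apply_of_ne (by decide)]; exact hw
  · intro hv
    refine ⟨reflectIso (d := 2) 0 v, ?_, ?_⟩
    · rw [reflectIso_apply_of_ne (by decide)]; exact hv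
    · exact reflect_reflect v

/-- **Exact reflection symmetry of `Q`**: `Q(i,j,k,l) = Q(−l,−k,−j,−i)` (reflection invariance of
`P_{1/2}` and of `ℤ×ℕ`, and the symmetry of crossing events in source and target). [folklore] -/
theorem crossing_reflect (i j k l : ℤ) :
    μ.real (openCrossing halfPlane (rowIcc (-l) (-k)) (rowIcc (-j) (-i))) =
      μ.real (openCrossing halfPlane (rowIcc i j) (rowIcc k l)) := by
  rw [openCrossing_comm, ← image_reflect_rowIcc i j, ← image_reflect_rowIcc k l]
  conv_lhs => rw [← image_reflect_halfPlane]
  unfold μ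
  exact bondPercolation_real_image (reflectIso (d := 2) 0) half _ _ _

/-- `⌊−x⌋ ≤ −⌊x⌋`. [folklore] -/
theorem floor_neg_le (x : ℝ) : ⌊-x⌋ ≤ -⌊x⌋ := by
  rw [Int.floor_neg]; have := Int.floor_le_ceil x; omega

/-- `−⌊x⌋ ≤ ⌊−x⌋ + 1`. [folklore] -/
theorem neg_floor_le (x : ℝ) : -⌊x⌋ ≤ ⌊-x⌋ + 1 := by
  rw [Int.floor_neg]; have := Int.ceil_le_floor_add_one x; omega

section Moves

variable {C α : ℝ}
  (hesc : ∀ p : unitInterval, (p : ℝ) ≤ 1 / 2 → ∀ r R : ℕ, 1 ≤ r → r ≤ R →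
    (bondPercolation (zdGraph 2) p).real
      {ω | ∃ x ∈ box 2 r, ∃ y ∉ box 2 R, ω ∈ openConnIn Set.univ x y} ≤ C * ((r : ℝ) / R) ^ α)
include hesc

/-- **Reflection costs `≤ 8C/R^α` at lattice level**: `P_n(−y,−c,−b,−a)` and `P_n(a,b,c,y)` differ by
at most twice the joint-move error with `m = 1`, `R = ⌊(c−b)n/2⌋`, once `(c − b) n ≥ 8`. [folklore] -/
theorem abs_reflect_sub_le {a b c y : ℝ} (hab : a ≤ b) (hbc : b < c) (hcy : c ≤ y) {n : ℕ}
    (hn : 8 ≤ (c - b) * n) :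
    |μ.real (openCrossing halfPlane (arcA (-y) (-c) n) (rowIcc ⌊(-b) * n⌋ ⌊(-a) * n⌋)) -
        μ.real (openCrossing halfPlane (arcA a b n) (rowIcc ⌊c * n⌋ ⌊y * n⌋))| ≤
      8 * (C * ((1 : ℝ) / ⌊(c - b) * n / 2⌋₊) ^ α) := by
  set g := c - b with hg
  have hg0 : 0 < g := by rw [hg]; linarith
  set R : ℕ := ⌊g * n / 2⌋₊ with hR
  have hR_le : (R : ℝ) ≤ g * n / 2 := Nat.floor_le (by positivity)
  have hR_ge : g * n / 2 - 1 < R := by rw [hR]; exact Nat.sub_one_lt_floor _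
  have hR1_real : (1 : ℝ) ≤ R := by linarith
  have hR1 : 1 ≤ R := by exact_mod_cast hR1_real
  have hya : ∀ x : ℝ, ⌊(-x) * (n : ℝ)⌋ = ⌊-(x * n)⌋ := fun x ↦ by rw [neg_mul]
  -- the upper corner w⁺ = (⌊−yn⌋, −⌊cn⌋, ⌊−bn⌋, −⌊an⌋)
  have hRgap : (R : ℤ) ≤ ⌊-(b * (n : ℝ))⌋ - (-⌊c * (n : ℝ)⌋) - 2 := by
    have h1 : (c * n : ℝ) < ⌊c * n⌋ + 1 := Int.lt_floor_add_one _
    have h2 : (-(b * n) : ℝ) < ⌊-(b * n)⌋ + 1 := Int.lt_floor_add_one _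
    have h3 : ((R : ℤ) : ℝ) < ((⌊-(b * (n : ℝ))⌋ - (-⌊c * (n : ℝ)⌋) - 2 : ℤ) : ℝ) := by
      push_cast
      have : (R : ℝ) ≤ g * n - 4 := by linarith
      rw [hg] at this
      linarith
    exact (Int.cast_lt.1 h3).le
  -- (A) the upper corner against the reflected lattice configuration u = (−⌊yn⌋, −⌊cn⌋, −⌊bn⌋, −⌊an⌋)
  have hA := move_le hesc (i := -⌊y * (n : ℝ)⌋) (i' := ⌊-(y * (n : ℝ))⌋) (j := -⌊c * (n : ℝ)⌋)
    (j' := -⌊c * (n : ℝ)⌋) (k := -⌊b * (n : ℝ)⌋) (k' := ⌊-(b * (n : ℝ))⌋) (l := -⌊a * (n : ℝ)⌋)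
    (l' := -⌊a * (n : ℝ)⌋) (m := 1) (R := R) (floor_neg_le _) le_rfl (floor_neg_le _) le_rfl
    (by have := floor_mul_le_floor_mul hcy n; omega)
    (by have := floor_mul_le_floor_mul hab n; omega) le_rfl hR1
    (by have := neg_floor_le (y * n); push_cast; omega) (by simp)
    (by have := neg_floor_le (b * n); push_cast; omega) (by simp) hRgap
  -- (B) the upper corner against u' = (⌊−yn⌋, ⌊−cn⌋, ⌊−bn⌋, ⌊−an⌋)
  have hB := move_le hesc (i := ⌊-(y * (n : ℝ))⌋) (i' := ⌊-(y * (n : ℝ))⌋) (j := ⌊-(c * (n : ℝ))⌋)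
    (j' := -⌊c * (n : ℝ)⌋) (k := ⌊-(b * (n : ℝ))⌋) (k' := ⌊-(b * (n : ℝ))⌋) (l := ⌊-(a * (n : ℝ))⌋)
    (l' := -⌊a * (n : ℝ)⌋) (m := 1) (R := R) le_rfl (floor_neg_le _) le_rfl (floor_neg_le _)
    (Int.floor_le_floor (by nlinarith)) (Int.floor_le_floor (by nlinarith)) le_rfl hR1 (by simp)
    (by have := neg_floor_le (c * n); push_cast; omega) (by simp)
    (by have := neg_floor_le (a * n); push_cast; omega) hRgap
  have hrefl := crossing_reflect ⌊a * (n : ℝ)⌋ ⌊b * (n : ℝ)⌋ ⌊c * (n : ℝ)⌋ ⌊y * (n : ℝ)⌋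
  rw [arcA_eq_rowIcc, arcA_eq_rowIcc, hya, hya, hya, hya, ← hrefl, abs_le]
  push_cast at hA hB ⊢
  constructor <;> nlinarith [hA.1, hA.2, hB.1, hB.2]

/-- **Asymptotic reflection symmetry of `P_n`**: `P_n(−y,−c,−b,−a) − P_n(a,b,c,y) → 0`. [folklore] -/
theorem tendsto_reflect_sub (hα : 0 < α) {a b c y : ℝ} (hab : a ≤ b) (hbc : b < c) (hcy : c ≤ y) :
    Tendsto (fun n : ℕ ↦
      μ.real (openCrossing halfPlane (arcA (-y) (-c) n) (rowIcc ⌊(-b) * n⌋ ⌊(-a) * n⌋)) -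
        μ.real (openCrossing halfPlane (arcA a b n) (rowIcc ⌊c * n⌋ ⌊y * n⌋))) atTop (𝓝 0) := by
  have hg0 : 0 < c - b := by linarith
  refine squeeze_zero_norm' ?_ (tendsto_translate_error C hα hg0)
  filter_upwards [(tendsto_natCast_atTop_atTop.const_mul_atTop hg0).eventually_ge_atTop 8] with n hn
  rw [Real.norm_eq_abs]
  exact abs_reflect_sub_le hesc hab hbc hcy hn

end Moves

/-! ## §10 Reflection symmetry of joint subsequential limits -/

/-- **Reflection symmetry**: a joint subsequential limit satisfies `G(−y,−c,−b,−a) = G(a,b,c,y)`.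
[folklore] -/
theorem reflect_of_jointLimit {θ : ℕ → ℕ} {G : ℝ → ℝ → ℝ → ℝ → ℝ}
    (hG : ∀ a b c y : ℝ, a < b → b < c → c < y →
      Tendsto (fun n ↦ μ.real (openCrossing halfPlane (arcA a b (θ n))
        (rowIcc ⌊c * (θ n : ℕ)⌋ ⌊y * (θ n : ℕ)⌋))) atTop (𝓝 (G a b c y)))
    (hθ : StrictMono θ) {a b c y : ℝ} (hab : a < b) (hbc : b < c) (hcy : c < y) :
    G (-y) (-c) (-b) (-a) = G a b c y := by
  obtain ⟨C, α, -, hα, hesc⟩ := exists_real_boxToFar_le_rpow_of_le_half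
  have h1 := hG (-y) (-c) (-b) (-a) (by linarith) (by linarith) (by linarith)
  have h2 := hG a b c y hab hbc hcy
  have h4 := (tendsto_reflect_sub hesc hα hab.le hbc hcy.le).comp hθ.tendsto_atTop
  have h5 := h2.add h4
  simp only [add_zero] at h5
  refine tendsto_nhds_unique h1 (h5.congr fun n ↦ ?_)
  simp only [Function.comp_apply]
  ring

end Subseq

/-- **Registered extra stub of line `Sketch` (lead c2-0): asymptotic reflection symmetry of `P_n`.**
`P_n(−y,−c,−b,−a) − P_n(a,b,c,y) → 0` for `a ≤ b < c ≤ y`. [folklore] -/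
theorem stub_reflectionSymmetry :
    ∀ (a b c y : ℝ), a ≤ b → b < c → c ≤ y →
      Tendsto (fun n : ℕ ↦
        μ.real (openCrossing halfPlane (arcA (-y) (-c) n) (rowIcc ⌊(-b) * n⌋ ⌊(-a) * n⌋)) -
          μ.real (openCrossing halfPlane (arcA a b n) (rowIcc ⌊c * n⌋ ⌊y * n⌋))) atTop (𝓝 0) := by
  obtain ⟨C, α, -, hα, hesc⟩ := exists_real_boxToFar_le_rpow_of_le_half
  exact fun a b c y hab hbc hcy ↦ Subseq.tendsto_reflect_sub hesc hα hab hbc hcy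

end Summit.CriticalPhenomena.CardyFormulaZ2.Cruxes.HalfPlaneMarkDensityLaw.SketchLine

end
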